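import Literature.AlgebraicGeometry.Frobenioids.GaloisEquivariantUnitsEndomorphismRigidity
import Literature.AlgebraicGeometry.Frobenioids.ArithDivisorMonoidRigidOfPrincipal
import HarnessLib

/-!
# Frobenioids I, Example 6.3: a natural endomorphism of the rational-function monoid `B = (Spec L ↦ L^×)` that
# relabels finite places on principal divisors is the IDENTITY (functor form of the classical rigidity)

Mochizuki, *The geometry of Frobenioids I: the general theory*, Kyushu J. Math. **62** (2008) 293–400, §6,
Example 6.3 pp. 112–114: on `D = B(Gal(F̃/F))⁰` (the tree's `FinSubextCat F K`, abc-iut-L1) the rational-function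
monoid `B : Spec L ↦ L^×` (the tree's `unitsFunctor F K`, `ArithmeticFrobenioidModel.lean`) and
`B(L) = L^× → Φ(L)^gp`, `f ↦ div(f)` (finite coordinates `ord_w(f)`, the tree's `ordFin`)
[cite: MochizukiFrdI2008, Ex. 6.3 p.113].

CLASSICAL LEMMA (OURS): no [IUTchI] / [FrdI] statement is asserted.  PROOF-ONLY sequel (cell abc-iut, seat
abc-iut-L5-t16 gen 13, row «BRIGID-KUMMER» file 2/2, abc-iut-L5-lead RULINGS #160 (1), dir word abc-iut-L1-lead R245)
of `GaloisEquivariantUnitsEndomorphismRigidity.lean` (the `ᾱ`-form: a `Gal(K/F)`-equivariant endomorphism of `K^×`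
relabelling finite places on principal divisors is the identity).  THIS FILE is the FUNCTOR FORM, the shape in which
the rational-function monoid of the [FrdI] Thm 5.2 model Frobenioid is transported by an equivalence (the tree's
`ModelFrobenioid.exists_comparisonData_of_equivalence`, `ModelFrobenioid.exists_unitAutTwist_selfEquivalence`):

* `unitsFunctor_exists_unitsEnd_agree` — every natural endomorphism `α` of `unitsFunctor F K` (`K/F` algebraic) is
  induced by ONE endomorphism `ᾱ` of `K^×`: `ᾱ(u) = α_{Spec L}(u)` for `u ∈ L^×`, for every object `Spec L` (glue
  along the inclusions `F(u) ⊆ L`, naturality of `α`);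
* `galEquivariant_of_unitsEnd_agree` — such an `ᾱ` commutes with `Gal(K/F)` (naturality of `α` along the
  isomorphisms `Spec σ(L) → Spec L`);
* **`unitsFunctor_natEnd_eq_id_of_ordFin_perm`** — if at ONE object `Spec L₀` the component `α_{Spec L₀}` relabels
  the finite places of `L₀` on principal divisors (`ord_{θ w}(α u) = ord_w(u)` for a permutation `θ` of
  `FinitePlace L₀`), then `α = 𝟙` (`K` algebraically closed, `K/F` Galois, `F` a number field): file 1 applied over
  the number field `L₀` (`Gal(K/L₀) ≤ Gal(K/F)`), then `α_{Spec L}(u) = ᾱ(u) = u` componentwise;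
* `perm_eq_refl_of_unitsFunctor_natEnd_ordFin_perm` — and `θ = 1`;
* **`unitsFunctor_natEnd_eq_id_of_divB_compat`** — the same conclusion from the RAW divisor-compatibility shape delivered
  by [FrdI] Cor 4.11 (iv) / Thm 5.2 (i) relation (d): a monoid AUTOMORPHISM `θ` of `Φ(L₀) = Multiplicative
  (EffArithDivisor L₀)` with `θ^gp (Div_B u) = Div_B (α u)` for all `u ∈ L₀^×` (`Div_B = gpEquiv⁻¹ ∘ div`, the tree's
  `divNatTrans`); the permutation of finite places is read off `θ` by abc-iut-L1's structure theorem
  `EffArithDivisor.exists_decomposition_monomial_mulEquiv` + `ArithDivisor.fin_apply_of_restrict` (the route of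
  `ArithDivisorMonoidRigidOfPrincipal.lean`); the archimedean coordinates of `θ` are never used.

Nothing here bears on, or takes a side on, [IUTchIII] Cor. 3.12; nothing here asserts anything about abc.
-/

noncomputable section

namespace Literature.AlgebraicGeometry.Frobenioids

open CategoryTheory Opposite NumberField

variable {F : Type} [Field F] {K : Type} [Field K] [Algebra F K]

/-! ### Bookkeeping on `unitsFunctor` -/

/-- `F ↪ K` is injective on units. [folklore] -/
private theorem unitsMap_algebraMap_injective' (L : IntermediateField F K) :
    Function.Injective (Units.map (algebraMap L K : L →* K)) := by
  intro x y hxy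
  have h := congrArg (fun z : Kˣ => (z : K)) hxy
  simp only [Units.coe_map, MonoidHom.coe_coe] at h
  exact Units.ext ((algebraMap L K).injective h)

/-- Naturality of an endomorphism `α` of `B = unitsFunctor F K` along `f : Spec L → Spec M`, elementwise:
`α_L (f^* v) = f^* (α_M v)`. [cite: MochizukiFrdI2008, Ex. 6.3 p.113] -/
theorem unitsFunctor_natEnd_naturality_apply (α : unitsFunctor F K ⟶ unitsFunctor F K) {X Y : FinSubextCat F K}
    (f : X ⟶ Y) (v : (Y.L)ˣ) :
    (α.app (op X)).hom (Units.map (f.toAlgHom : Y.L →* X.L) v) =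
      Units.map (f.toAlgHom : Y.L →* X.L) ((α.app (op Y)).hom v) := by
  have h := congrArg (fun φ : (unitsFunctor F K).obj (op Y) ⟶ (unitsFunctor F K).obj (op X) => φ.hom v)
    (α.naturality f.op)
  simp only [CommMonCat.hom_comp, MonoidHom.comp_apply] at h
  exact h

/-- The unit of `Spec L` underlying `x ∈ K^×` when `x, x⁻¹ ∈ L`. (Private plumbing.) [folklore] -/
private theorem exists_unitsMap_algebraMap_eq (L : IntermediateField F K) (x : Kˣ) (hx : (x : K) ∈ L) :
    ∃ u : Lˣ, Units.map (algebraMap L K : L →* K) u = x :=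
  ⟨⟨⟨x, hx⟩, ⟨(x⁻¹ : Kˣ), by simpa [Units.val_inv_eq_inv_val] using inv_mem hx⟩,
      Subtype.ext (by simp), Subtype.ext (by simp)⟩, Units.ext rfl⟩

/-! ### Every natural endomorphism of `B` comes from ONE endomorphism of `K^×` -/

/-- **Gluing**: for `K/F` algebraic, every natural endomorphism `α` of `B = unitsFunctor F K` is induced by an
endomorphism `ᾱ` of `K^×` — `ᾱ(u) = α_{Spec L}(u)` for every object `Spec L` and every `u ∈ L^×` (define `ᾱ(x)`
through `Spec F(x)`; independence of `L` and multiplicativity by naturality along the inclusions `F(x) ⊆ L`,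
`F(x), F(y) ⊆ F(x, y)`). [cite: MochizukiFrdI2008, Ex. 6.3 p.113] -/
theorem unitsFunctor_exists_unitsEnd_agree [Algebra.IsAlgebraic F K] (α : unitsFunctor F K ⟶ unitsFunctor F K) :
    ∃ ᾱ : Kˣ →* Kˣ, ∀ (X : FinSubextCat F K) (u : (X.L)ˣ),
      ᾱ (Units.map (algebraMap X.L K : X.L →* K) u) =
        Units.map (algebraMap X.L K : X.L →* K) ((α.app (op X)).hom u) := by
  classical
  -- the object `Spec F(x)` and the unit `x ∈ F(x)^×`
  have hfd : ∀ x : Kˣ, FiniteDimensional F (IntermediateField.adjoin F {(x : K)}) := fun x =>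
    IntermediateField.adjoin.finiteDimensional (Algebra.IsAlgebraic.isAlgebraic (R := F) (x : K)).isIntegral
  let obj : Kˣ → FinSubextCat F K := fun x => @FinSubextCat.mk F _ K _ _ (IntermediateField.adjoin F {(x : K)}) (hfd x)
  have hmem : ∀ x : Kˣ, (x : K) ∈ (obj x).L := fun x => IntermediateField.mem_adjoin_simple_self F (x : K)
  let unitOf : ∀ x : Kˣ, ((obj x).L)ˣ := fun x => (exists_unitsMap_algebraMap_eq (obj x).L x (hmem x)).choose
  have hunitOf : ∀ x : Kˣ, Units.map (algebraMap (obj x).L K : (obj x).L →* K) (unitOf x) = x := fun x =>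
    (exists_unitsMap_algebraMap_eq (obj x).L x (hmem x)).choose_spec
  let ᾱ₀ : Kˣ → Kˣ := fun x => Units.map (algebraMap (obj x).L K : (obj x).L →* K) ((α.app (op (obj x))).hom (unitOf x))
  -- KEY: `ᾱ₀` agrees with `α` at every object
  have hagree : ∀ (X : FinSubextCat F K) (u : (X.L)ˣ),
      ᾱ₀ (Units.map (algebraMap X.L K : X.L →* K) u) =
        Units.map (algebraMap X.L K : X.L →* K) ((α.app (op X)).hom u) := by
    intro X u
    set x : Kˣ := Units.map (algebraMap X.L K : X.L →* K) u with hx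
    have hle : (obj x).L ≤ X.L := by
      change IntermediateField.adjoin F {(x : K)} ≤ X.L
      rw [IntermediateField.adjoin_le_iff, Set.singleton_subset_iff]
      exact (u : X.L).2
    -- the inclusion `Spec X.L → Spec F(x)`
    let g : X ⟶ obj x := ⟨IntermediateField.inclusion hle⟩
    have hgu : Units.map (g.toAlgHom : (obj x).L →* X.L) (unitOf x) = u := by
      apply unitsMap_algebraMap_injective' X.L
      rw [← hx]
      exact (Units.ext rfl :
        Units.map (algebraMap X.L K : X.L →* K) (Units.map (g.toAlgHom : (obj x).L →* X.L) (unitOf x)) =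
          Units.map (algebraMap (obj x).L K : (obj x).L →* K) (unitOf x)).trans (hunitOf x)
    have hnat := unitsFunctor_natEnd_naturality_apply α g (unitOf x)
    rw [hgu] at hnat
    calc ᾱ₀ x = Units.map (algebraMap (obj x).L K : (obj x).L →* K) ((α.app (op (obj x))).hom (unitOf x)) := rfl
      _ = Units.map (algebraMap X.L K : X.L →* K)
            (Units.map (g.toAlgHom : (obj x).L →* X.L) ((α.app (op (obj x))).hom (unitOf x))) := Units.ext rfl
      _ = Units.map (algebraMap X.L K : X.L →* K) ((α.app (op X)).hom u) :=
            congrArg (Units.map (algebraMap X.L K : X.L →* K)) hnat.symm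
  -- multiplicativity through `Spec F(x, y)`
  refine ⟨{ toFun := ᾱ₀, map_one' := ?_, map_mul' := ?_ }, hagree⟩
  · have h1 : (α.app (op (obj 1))).hom (1 : ((obj 1).L)ˣ) = 1 := map_one _
    calc ᾱ₀ 1 = ᾱ₀ (Units.map (algebraMap (obj 1).L K : (obj 1).L →* K) 1) := by rw [map_one]
      _ = Units.map (algebraMap (obj 1).L K : (obj 1).L →* K) ((α.app (op (obj 1))).hom 1) := hagree (obj 1) 1
      _ = Units.map (algebraMap (obj 1).L K : (obj 1).L →* K) 1 := congrArg _ h1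
      _ = 1 := map_one _
  · intro x y
    haveI : FiniteDimensional F (IntermediateField.adjoin F {(x : K), (y : K)}) :=
      IntermediateField.finiteDimensional_adjoin fun z _ => (Algebra.IsAlgebraic.isAlgebraic (R := F) z).isIntegral
    let Z : FinSubextCat F K := ⟨IntermediateField.adjoin F {(x : K), (y : K)}⟩
    have hxZ : (x : K) ∈ Z.L := IntermediateField.subset_adjoin F _ (by simp)
    have hyZ : (y : K) ∈ Z.L := IntermediateField.subset_adjoin F _ (by simp)
    obtain ⟨ux, hux⟩ := exists_unitsMap_algebraMap_eq Z.L x hxZ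
    obtain ⟨uy, huy⟩ := exists_unitsMap_algebraMap_eq Z.L y hyZ
    have h2 : (α.app (op Z)).hom (ux * uy) = (α.app (op Z)).hom ux * (α.app (op Z)).hom uy := map_mul _ _ _
    calc ᾱ₀ (x * y) = ᾱ₀ (Units.map (algebraMap Z.L K : Z.L →* K) (ux * uy)) := by rw [map_mul, hux, huy]
      _ = Units.map (algebraMap Z.L K : Z.L →* K) ((α.app (op Z)).hom (ux * uy)) := hagree Z _
      _ = Units.map (algebraMap Z.L K : Z.L →* K) ((α.app (op Z)).hom ux * (α.app (op Z)).hom uy) :=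
            congrArg _ h2
      _ = Units.map (algebraMap Z.L K : Z.L →* K) ((α.app (op Z)).hom ux) *
            Units.map (algebraMap Z.L K : Z.L →* K) ((α.app (op Z)).hom uy) := map_mul _ _ _
      _ = ᾱ₀ (Units.map (algebraMap Z.L K : Z.L →* K) ux) * ᾱ₀ (Units.map (algebraMap Z.L K : Z.L →* K) uy) := by
            rw [hagree Z ux, hagree Z uy]
      _ = ᾱ₀ x * ᾱ₀ y := by rw [hux, huy]

/-! ### Such an `ᾱ` is `Gal(K/F)`-equivariant -/

/-- **Equivariance from naturality**: if `ᾱ` induces `α` at every object, then `ᾱ` commutes with every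
`σ ∈ Gal(K/F)` — naturality of `α` along the isomorphism `Spec σ(L) → Spec L` of `D` given by `σ|_L : L ⥲ σ(L)`.
[cite: MochizukiFrdI2008, Ex. 6.3 p.113] -/
theorem galEquivariant_of_unitsEnd_agree [Algebra.IsAlgebraic F K] (α : unitsFunctor F K ⟶ unitsFunctor F K)
    (ᾱ : Kˣ →* Kˣ)
    (hagree : ∀ (X : FinSubextCat F K) (u : (X.L)ˣ), ᾱ (Units.map (algebraMap X.L K : X.L →* K) u) =
      Units.map (algebraMap X.L K : X.L →* K) ((α.app (op X)).hom u))
    (σ : K ≃ₐ[F] K) (x : Kˣ) : ᾱ (Units.map (σ : K →* K) x) = Units.map (σ : K →* K) (ᾱ x) := by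
  classical
  haveI : FiniteDimensional F (IntermediateField.adjoin F {(x : K)}) :=
    IntermediateField.adjoin.finiteDimensional (Algebra.IsAlgebraic.isAlgebraic (R := F) (x : K)).isIntegral
  let X : FinSubextCat F K := ⟨IntermediateField.adjoin F {(x : K)}⟩
  let σX : FinSubextCat F K := ⟨(IntermediateField.adjoin F {(x : K)}).map (σ : K →ₐ[F] K)⟩
  obtain ⟨u, hu⟩ := exists_unitsMap_algebraMap_eq X.L x (IntermediateField.mem_adjoin_simple_self F (x : K))
  -- the morphism `Spec σ(L) → Spec L` given by `σ|_L`
  let g : σX ⟶ X := ⟨(IntermediateField.equivMap X.L (σ : K →ₐ[F] K)).toAlgHom⟩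
  have hσu : Units.map (σ : K →* K) (Units.map (algebraMap X.L K : X.L →* K) u) =
      Units.map (algebraMap σX.L K : σX.L →* K) (Units.map (g.toAlgHom : X.L →* σX.L) u) :=
    Units.ext rfl
  have hσαu : Units.map (σ : K →* K) (Units.map (algebraMap X.L K : X.L →* K) ((α.app (op X)).hom u)) =
      Units.map (algebraMap σX.L K : σX.L →* K)
        (Units.map (g.toAlgHom : X.L →* σX.L) ((α.app (op X)).hom u)) :=
    Units.ext rfl
  calc ᾱ (Units.map (σ : K →* K) x)
        = ᾱ (Units.map (σ : K →* K) (Units.map (algebraMap X.L K : X.L →* K) u)) := by rw [hu]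
    _ = ᾱ (Units.map (algebraMap σX.L K : σX.L →* K) (Units.map (g.toAlgHom : X.L →* σX.L) u)) := by rw [hσu]
    _ = Units.map (algebraMap σX.L K : σX.L →* K)
          ((α.app (op σX)).hom (Units.map (g.toAlgHom : X.L →* σX.L) u)) := hagree σX _
    _ = Units.map (algebraMap σX.L K : σX.L →* K)
          (Units.map (g.toAlgHom : X.L →* σX.L) ((α.app (op X)).hom u)) :=
          congrArg _ (unitsFunctor_natEnd_naturality_apply α g u)
    _ = Units.map (σ : K →* K) (Units.map (algebraMap X.L K : X.L →* K) ((α.app (op X)).hom u)) := hσαu.symm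
    _ = Units.map (σ : K →* K) (ᾱ (Units.map (algebraMap X.L K : X.L →* K) u)) := by rw [hagree X u]
    _ = Units.map (σ : K →* K) (ᾱ x) := by rw [hu]

/-! ### The theorem -/

section Rigidity

variable [NumberField F] [IsGalois F K] [IsAlgClosed K] (α : unitsFunctor F K ⟶ unitsFunctor F K)
  (X₀ : FinSubextCat F K) (θ : Equiv.Perm (FinitePlace X₀.L))
  (hval : ∀ (u : (X₀.L)ˣ) (w : FinitePlace X₀.L), ordFin X₀.L (θ w) ((α.app (op X₀)).hom u) = ordFin X₀.L w u)

include hval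

/-- **A natural endomorphism of `B = unitsFunctor F K` whose component at ONE object `Spec L₀` relabels the finite
places of `L₀` on principal divisors is the identity** (`F` a number field, `K/F` Galois, `K` algebraically closed —
e.g. `K = F̄`): glue `α` to a `Gal(K/F)`-equivariant — a fortiori `Gal(K/L₀)`-equivariant — endomorphism `ᾱ` of `K^×`
and apply `eq_id_of_galEquivariant_of_ordFin_perm` over the number field `L₀`.
[cite: MochizukiFrdI2008, Ex. 6.3 p.113] -/
theorem unitsFunctor_natEnd_eq_id_of_ordFin_perm : α = 𝟙 (unitsFunctor F K) := by
  obtain ⟨ᾱ, hagree⟩ := unitsFunctor_exists_unitsEnd_agree α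
  haveI : IsGalois X₀.L K := IsGalois.tower_top_of_isGalois F X₀.L K
  -- file 1 over the number field `L₀`
  have hσ : ∀ (σ : K ≃ₐ[X₀.L] K) (x : Kˣ), ᾱ (Units.map (σ : K →* K) x) = Units.map (σ : K →* K) (ᾱ x) :=
    fun σ x => galEquivariant_of_unitsEnd_agree α ᾱ hagree (σ.restrictScalars F) x
  have hval' : ∀ u : (X₀.L)ˣ, ∃ u' : (X₀.L)ˣ,
      Units.map (algebraMap X₀.L K : X₀.L →* K) u' = ᾱ (Units.map (algebraMap X₀.L K : X₀.L →* K) u) ∧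
        ∀ w : FinitePlace X₀.L, ordFin X₀.L (θ w) u' = ordFin X₀.L w u :=
    fun u => ⟨(α.app (op X₀)).hom u, (hagree X₀ u).symm, hval u⟩
  have hid := eq_id_of_galEquivariant_of_ordFin_perm ᾱ hσ θ hval'
  -- componentwise
  refine NatTrans.ext (funext fun X => ?_)
  cases X with
  | op X =>
    apply CommMonCat.hom_ext
    refine MonoidHom.ext fun u => ?_
    rw [NatTrans.id_app, CommMonCat.hom_id, MonoidHom.id_apply]
    apply unitsMap_algebraMap_injective' X.L
    rw [← hagree X u, hid, MonoidHom.id_apply]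

/-- … and the permutation `θ` is the identity. [cite: MochizukiFrdI2008, Ex. 6.3 p.113] -/
theorem perm_eq_refl_of_unitsFunctor_natEnd_ordFin_perm : θ = Equiv.refl _ := by
  obtain ⟨ᾱ, hagree⟩ := unitsFunctor_exists_unitsEnd_agree α
  haveI : IsGalois X₀.L K := IsGalois.tower_top_of_isGalois F X₀.L K
  have hσ : ∀ (σ : K ≃ₐ[X₀.L] K) (x : Kˣ), ᾱ (Units.map (σ : K →* K) x) = Units.map (σ : K →* K) (ᾱ x) :=
    fun σ x => galEquivariant_of_unitsEnd_agree α ᾱ hagree (σ.restrictScalars F) x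
  have hval' : ∀ u : (X₀.L)ˣ, ∃ u' : (X₀.L)ˣ,
      Units.map (algebraMap X₀.L K : X₀.L →* K) u' = ᾱ (Units.map (algebraMap X₀.L K : X₀.L →* K) u) ∧
        ∀ w : FinitePlace X₀.L, ordFin X₀.L (θ w) u' = ordFin X₀.L w u :=
    fun u => ⟨(α.app (op X₀)).hom u, (hagree X₀ u).symm, hval u⟩
  exact perm_eq_refl_of_galEquivariant_of_ordFin_perm ᾱ hσ θ hval'

end Rigidity

section RawDiv

variable [NumberField F] [IsGalois F K] [IsAlgClosed K]

/-- **The RAW divisor-compatibility form.**  If at ONE object `Spec L₀` there is a monoid automorphism `θ` of the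
effective arithmetic divisors `Φ(L₀)` whose groupification carries `Div_B(u)` to `Div_B(α_{L₀} u)` for every
`u ∈ L₀^×` — the shape in which a self-equivalence of the model Frobenioid moves principal divisors ([FrdI] Cor 4.11
(iv) with Thm 5.2 (i) relation (d)) — then `α = 𝟙`: the finite part of `θ` is a relabelling `π` of the finite places
(`EffArithDivisor.exists_decomposition_monomial_mulEquiv`), whence `ord_{π w}(α u) = ord_w(u)`
(`ArithDivisor.fin_apply_of_restrict`), and `unitsFunctor_natEnd_eq_id_of_ordFin_perm` applies.
[cite: MochizukiFrdI2008, Ex. 6.3 p.113] -/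
theorem unitsFunctor_natEnd_eq_id_of_divB_compat (α : unitsFunctor F K ⟶ unitsFunctor F K) (X₀ : FinSubextCat F K)
    (θ : Multiplicative (EffArithDivisor X₀.L) ≃* Multiplicative (EffArithDivisor X₀.L))
    (hdiv : ∀ u : (X₀.L)ˣ,
      MonGp.map θ.toMonoidHom ((EffArithDivisor.gpEquiv X₀.L).symm (principalArithDivisorHom X₀.L u)) =
        (EffArithDivisor.gpEquiv X₀.L).symm (principalArithDivisorHom X₀.L ((α.app (op X₀)).hom u))) :
    α = 𝟙 (unitsFunctor F K) := by
  classical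
  -- structure of `θ`: `θ (f, t) = (π_* f, σ_* (c · t))`
  obtain ⟨π, -, -, -, -, h1, -⟩ := EffArithDivisor.exists_decomposition_monomial_mulEquiv θ
  let eE : EffArithDivisor X₀.L →+ EffArithDivisor X₀.L := (AddEquiv.toMultiplicative.symm θ).toAddMonoidHom
  let θG : Multiplicative (ArithDivisor X₀.L) →* Multiplicative (ArithDivisor X₀.L) :=
    (EffArithDivisor.gpEquiv X₀.L).toMonoidHom.comp
      ((MonGp.map θ.toMonoidHom).comp (EffArithDivisor.gpEquiv X₀.L).symm.toMonoidHom)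
  let eG : ArithDivisor X₀.L →+ ArithDivisor X₀.L := AddMonoidHom.toMultiplicative.symm θG
  have heG_apply : ∀ d, eG d = Multiplicative.toAdd ((EffArithDivisor.gpEquiv X₀.L)
      (MonGp.map θ.toMonoidHom ((EffArithDivisor.gpEquiv X₀.L).symm (Multiplicative.ofAdd d)))) := fun d => rfl
  have heG : ∀ D, eG (EffArithDivisor.toArithDivisor X₀.L D) = EffArithDivisor.toArithDivisor X₀.L (eE D) := by
    intro D
    rw [heG_apply, EffArithDivisor.gpEquiv_symm_ofAdd_toArithDivisor, MonGp.map_of, EffArithDivisor.gpEquiv_apply,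
      EffArithDivisor.gpHom_of, toAdd_ofAdd]
    rfl
  -- `eG (div u) = div (α u)`
  have hmove : ∀ u : (X₀.L)ˣ,
      eG (principalArithDivisor X₀.L u) = principalArithDivisor X₀.L ((α.app (op X₀)).hom u) := by
    intro u
    rw [heG_apply]
    change Multiplicative.toAdd ((EffArithDivisor.gpEquiv X₀.L) (MonGp.map θ.toMonoidHom
      ((EffArithDivisor.gpEquiv X₀.L).symm (principalArithDivisorHom X₀.L u)))) = _
    rw [hdiv u, MulEquiv.apply_symm_apply]
    rfl
  have h1' : ∀ D : EffArithDivisor X₀.L, (eE D).1 = Finsupp.equivMapDomain π D.1 := fun D => h1 D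
  -- finite coordinates: `ord_{π w}(α u) = ord_w(u)`
  have hval : ∀ (u : (X₀.L)ˣ) (w : FinitePlace X₀.L),
      ordFin X₀.L (π w) ((α.app (op X₀)).hom u) = ordFin X₀.L w u := by
    intro u w
    have h := ArithDivisor.fin_apply_of_restrict eG eE heG h1' (principalArithDivisor X₀.L u) w
    rwa [hmove, principalArithDivisor_fst, principalArithDivisor_fst] at h
  exact unitsFunctor_natEnd_eq_id_of_ordFin_perm α X₀ π hval

end RawDiv

end Literature.AlgebraicGeometry.Frobenioids

end
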